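import Summits.BirchSwinnertonDyer.BirchSwinnertonDyer.Theorems.ByReductionTypeAtTwoTorsionEulerCharH46Obstruction
import Literature.NumberTheory.EllipticCurves.CyclotomicLayerTatePairing
import Literature.NumberTheory.EllipticCurves.WeilPairingLevelCompatProofs
import Literature.NumberTheory.EllipticCurves.WeilPairingShapiroLevelTransport
import Literature.NumberTheory.EllipticCurves.IwasawaTwistModPShapiroConj
import Literature.NumberTheory.EllipticCurves.DiscretePairingOfFun
import Literature.NumberTheory.GaloisRepresentations.LocalKummerTorsion
import Literature.NumberTheory.GaloisRepresentations.ContinuousCupProductCompatMixed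
import Literature.NumberTheory.GaloisRepresentations.ContinuousShapiroOpenCoinducedMackeyDegree
import Literature.Algebra.Homology.DiscreteRepGaloisCorollaries
import HarnessLib

/-!
# Greenberg LNM 1716 Lemma 4.6 on `Γ`-invariants (H46), kernel road C′, brick B6a: the obstruction at `v₀` for a local class
# INCLUDED from level `p^j` dies as soon as the corestriction of the REDUCED layer class dies — socket (HB6) of
# `…TorsionEulerCharH46Assembly` reduced to the universal-norm statement of brick B6

Cell `bsd-2adic` (run/shared/lean/pub/bsd-2adic/), seat `bsd-2adic-tower-1` GEN 34; `--supports stmt-BirchSwinnertonDyer-19271` (helper).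
THEOREMS ONLY (no definition, no named fact, no `sorry`); closes no item; nothing booked; BSD is not proved by any of this.

The socket (HB6) of `TorsionEulerChar.H46Assembly.exists_realiser_of_sockets` asks, for the local class `zt ∈ H¹(ℚ_v, E[p^N])` and every
dual layer class `b ∈ H¹(Γ_n, E[p^N])`, that `inv_v((e_{p^N}|_{Γ_{ℚ_v}}) (zt ∪ loc_v cor b)) = 0`. When `zt = ι_* zt_j` is INCLUDED from level
`p^j ≤ p^N` (the Kummer lift of a `p^j`-torsion class of `H¹(ℚ_v, E)` may be so chosen), the Weil compatibility
`e_{p^N}(ι S, T) = e_{p^j}(S, p^{N-j} T)` (Silverman III.8.1 (e), tree `weilPairingFun_mul_right`) and the naturality of `cor` and `loc`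
in the coefficients give

  `zt ∪_{e_N} loc cor_N b = (μ_{p^j} ⊆ μ_{p^N})_* (zt_j ∪_{e_j} loc cor_j (r_* b))`,  `r = p^{N-j} · : E[p^N] → E[p^j]`,

so the obstruction vanishes as soon as `cor_j (r_* b) = 0` — which is what brick B6 (universal norms of the compact ♭-Selmer tower,
Greenberg pp. 105–108) delivers for `N ≫ j`.

* `canonical_cupProduct_incl_eq_zero_of_cores_reduce_eq_zero` — the displayed implication, for any open `U ≤ Γ_ℚ` of finite index, any
  finite place `v`, abstract level maps `ι : E[p^j] → E[p^N]` (the inclusion on points) and `r : E[p^N] → E[p^j]` (`p^{N-j} ·` on points).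

References: [SilvermanAEC2009] Prop. III.8.1 (e); [NeukirchSchmidtWingberg2008] I §4 (1.4.2), I §5 (Cor is a morphism of δ-functors);
[GreenbergLNM1716] §4 Lemma 4.6 (p. 105), Lemma 4.7 (p. 108).
-/

set_option autoImplicit false
-- the Theorems namespace of this sub repeats the summit name by design (D-0017 nested layout)
set_option linter.dupNamespace false

noncomputable section

open scoped Classical NumberField ContRepresentation

namespace Summit.BirchSwinnertonDyer.BirchSwinnertonDyer.Theorems

namespace TorsionEulerChar.H46Obstruction

open CategoryTheory Field NumberField IsDedekindDomain
  Literature.NumberTheory.EllipticCurves Literature.NumberTheory.EllipticCurves.CyclotomicLayer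
  Literature.NumberTheory.GaloisRepresentations Literature.NumberTheory.GaloisRepresentations.DiscreteGaloisModule
  Literature.NumberTheory.GaloisCohomology
open _root_.TopRep _root_.ContinuousCohomology
open Literature.Algebra.Homology.DiscreteRep (toTopRepHom)

/-- **(HB6) from the vanishing of the corestriction of the reduced class.** `K = ℚ`, `p` prime, `j ≤ N`, `U ≤ Γ_ℚ` open of finite index,
`v` a finite place, `θ = absGaloisRestrict ℚ ℚ_v`; `ι : E[p^j] → E[p^N]` the inclusion and `r : E[p^N] → E[p^j]` the multiplication by
`p^{N-j}` (as continuous `Γ_ℚ`-intertwining maps, characterised by their values on points); `e_k = weilTowerPk W k` THE Weil pairings.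
For a local class `zt_j ∈ H¹(ℚ_v, E[p^j])` and a layer class `b ∈ H¹(U, E[p^N])` with `cor_j (r_* b) = 0`:
`inv_v((e_N|_θ)(ι_* zt_j ∪ loc_v cor_N b)) = 0`. Proof: `ι_* zt_j ∪_{e_N} y = (μ_{p^j} ⊆ μ_{p^N})_* (zt_j ∪_{e_j} r_* y)`
(`ContPairing.cupProduct_map_adjoint'` with `e_N(ι S, T) = e_j(S, p^{N-j} T)`, `weilPairingFun_mul_right`), and
`r_* loc_v cor_N b = loc_v cor_j (r_* b) = 0` (`cohomologyMap_cores`, naturality of `loc_v`).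
[cite: SilvermanAEC2009, Prop. III.8.1(e)] [cite: NeukirchSchmidtWingberg2008, I §4 (1.4.2) and I §5] -/
theorem canonical_cupProduct_incl_eq_zero_of_cores_reduce_eq_zero (W : WeierstrassCurve ℚ) [W.IsElliptic] (p : ℕ) [Fact p.Prime]
    {j N : ℕ} (hjN : j ≤ N) (U : Subgroup (absoluteGaloisGroup ℚ)) (hU : IsOpen (U : Set (absoluteGaloisGroup ℚ)))
    [Fintype (absoluteGaloisGroup ℚ ⧸ U)] (v : HeightOneSpectrum (𝓞 ℚ))
    [CompactSpace (absoluteGaloisGroup ℚ)] [CompactSpace (absoluteGaloisGroup (v.adicCompletion ℚ))]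
    (ι : (W.torsionGaloisModule ((p ^ j : ℕ) : ℤ)).toContRepresentation →ⁱL
      (W.torsionGaloisModule ((p ^ N : ℕ) : ℤ)).toContRepresentation)
    (hι : ∀ P : W.geomTorsion ((p ^ j : ℕ) : ℤ), ((ι P : W.geomTorsion ((p ^ N : ℕ) : ℤ)) : W.geomPoints) = (P : W.geomPoints))
    (r : (W.torsionGaloisModule ((p ^ N : ℕ) : ℤ)).toContRepresentation →ⁱL
      (W.torsionGaloisModule ((p ^ j : ℕ) : ℤ)).toContRepresentation)
    (hr : ∀ P : W.geomTorsion ((p ^ N : ℕ) : ℤ),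
      ((r P : W.geomTorsion ((p ^ j : ℕ) : ℤ)) : W.geomPoints) = ((p ^ (N - j) : ℕ) : ℤ) • (P : W.geomPoints))
    (ztj : continuousCohomology 1
      (TopRep.res (absGaloisRestrict ℚ (v.adicCompletion ℚ) : absoluteGaloisGroup (v.adicCompletion ℚ) →* absoluteGaloisGroup ℚ)
        (W.torsionGaloisModule ((p ^ j : ℕ) : ℤ)).toTopRep))
    (b : continuousCohomology 1 (subgroupRep (W.torsionGaloisModule ((p ^ N : ℕ) : ℤ)).toTopRep U))
    (hb : cores (W.torsionGaloisModule ((p ^ j : ℕ) : ℤ)).toTopRep U hU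
      (cohomologyMap (subgroupRepHom (toTopRepHom (W.torsionGaloisModule ((p ^ N : ℕ) : ℤ))
        (W.torsionGaloisModule ((p ^ j : ℕ) : ℤ)) r) U) 1 b) = 0) :
    LocalInvariants.canonical ℚ (p ^ N) (Sum.inr v)
      ((((contPairingOfFun (W.torsionGaloisModule ((p ^ N : ℕ) : ℤ)) (p ^ N) (weilTowerPk W N) (weilTowerPk_pow W N)
          (weilTowerPk_add_left W N) (weilTowerPk_add_right W N) (weilTowerPk_smul W N)).restrict
          (absGaloisRestrict ℚ (v.adicCompletion ℚ))).cupProduct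
        (cohomologyMap ((TopRep.resFunctor (absGaloisRestrict ℚ (v.adicCompletion ℚ) :
            absoluteGaloisGroup (v.adicCompletion ℚ) →* absoluteGaloisGroup ℚ)).map
          (toTopRepHom (W.torsionGaloisModule ((p ^ j : ℕ) : ℤ)) (W.torsionGaloisModule ((p ^ N : ℕ) : ℤ)) ι)) 1 ztj)
        (ContinuousCohomology.map (absGaloisRestrict ℚ (v.adicCompletion ℚ))
          (𝟙 (TopRep.res (absGaloisRestrict ℚ (v.adicCompletion ℚ) :
            absoluteGaloisGroup (v.adicCompletion ℚ) →* absoluteGaloisGroup ℚ) (W.torsionGaloisModule ((p ^ N : ℕ) : ℤ)).toTopRep)) 1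
          (cores (W.torsionGaloisModule ((p ^ N : ℕ) : ℤ)).toTopRep U hU b)))) = 0 := by
  have hlev : p ^ j * p ^ (N - j) = p ^ N := by rw [← pow_add, Nat.add_sub_cancel' hjN]
  have hdvd : p ^ j ∣ p ^ N := pow_dvd_pow p hjN
  have hmm' : ((p ^ j * p ^ (N - j) : ℕ) : ℚ) ≠ 0 := by rw [hlev]; exact natCast_pow_prime_ne_zero (p := p) N
  /- (1) the reduced local class vanishes: `r_* (loc cor_N b) = loc (cor_j (r_* b)) = 0` -/
  have hY : cohomologyMap ((TopRep.resFunctor (absGaloisRestrict ℚ (v.adicCompletion ℚ) :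
        absoluteGaloisGroup (v.adicCompletion ℚ) →* absoluteGaloisGroup ℚ)).map
        (toTopRepHom (W.torsionGaloisModule ((p ^ N : ℕ) : ℤ)) (W.torsionGaloisModule ((p ^ j : ℕ) : ℤ)) r)) 1
      (ContinuousCohomology.map (absGaloisRestrict ℚ (v.adicCompletion ℚ))
        (𝟙 (TopRep.res (absGaloisRestrict ℚ (v.adicCompletion ℚ) :
          absoluteGaloisGroup (v.adicCompletion ℚ) →* absoluteGaloisGroup ℚ) (W.torsionGaloisModule ((p ^ N : ℕ) : ℤ)).toTopRep)) 1
        (cores (W.torsionGaloisModule ((p ^ N : ℕ) : ℤ)).toTopRep U hU b)) = 0 := by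
    have h1 := cohomologyMap_map_id_eq_map (W.torsionGaloisModule ((p ^ N : ℕ) : ℤ)).toTopRep
      (absGaloisRestrict ℚ (v.adicCompletion ℚ))
      ((TopRep.resFunctor (absGaloisRestrict ℚ (v.adicCompletion ℚ) :
        absoluteGaloisGroup (v.adicCompletion ℚ) →* absoluteGaloisGroup ℚ)).map
        (toTopRepHom (W.torsionGaloisModule ((p ^ N : ℕ) : ℤ)) (W.torsionGaloisModule ((p ^ j : ℕ) : ℤ)) r)) 1
      (cores (W.torsionGaloisModule ((p ^ N : ℕ) : ℤ)).toTopRep U hU b)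
    have h2 := map_cohomologyMap_eq_map (absGaloisRestrict ℚ (v.adicCompletion ℚ))
      (toTopRepHom (W.torsionGaloisModule ((p ^ N : ℕ) : ℤ)) (W.torsionGaloisModule ((p ^ j : ℕ) : ℤ)) r)
      (𝟙 (TopRep.res (absGaloisRestrict ℚ (v.adicCompletion ℚ) :
        absoluteGaloisGroup (v.adicCompletion ℚ) →* absoluteGaloisGroup ℚ) (W.torsionGaloisModule ((p ^ j : ℕ) : ℤ)).toTopRep)) 1
      (cores (W.torsionGaloisModule ((p ^ N : ℕ) : ℤ)).toTopRep U hU b)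
    rw [Category.comp_id, cohomologyMap_cores, hb, map_zero] at h2
    exact h1.trans h2.symm
  /- (2) the Weil compatibility `e_N(ι S, T) = e_j(S, p^{N-j} T)` on the `μ`-carriers -/
  have hc : ∀ (x : W.geomTorsion ((p ^ j : ℕ) : ℤ)) (y : W.geomTorsion ((p ^ N : ℕ) : ℤ)),
      ((TopRep.resFunctor (absGaloisRestrict ℚ (v.adicCompletion ℚ) :
          absoluteGaloisGroup (v.adicCompletion ℚ) →* absoluteGaloisGroup ℚ)).map (muInclHom ℚ hdvd)).hom
        (((contPairingOfFun (W.torsionGaloisModule ((p ^ j : ℕ) : ℤ)) (p ^ j) (weilTowerPk W j) (weilTowerPk_pow W j)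
          (weilTowerPk_add_left W j) (weilTowerPk_add_right W j) (weilTowerPk_smul W j)).restrict
          (absGaloisRestrict ℚ (v.adicCompletion ℚ))).toLin x
          (((TopRep.resFunctor (absGaloisRestrict ℚ (v.adicCompletion ℚ) :
            absoluteGaloisGroup (v.adicCompletion ℚ) →* absoluteGaloisGroup ℚ)).map
            (toTopRepHom (W.torsionGaloisModule ((p ^ N : ℕ) : ℤ)) (W.torsionGaloisModule ((p ^ j : ℕ) : ℤ)) r)).hom y)) =
      ((contPairingOfFun (W.torsionGaloisModule ((p ^ N : ℕ) : ℤ)) (p ^ N) (weilTowerPk W N) (weilTowerPk_pow W N)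
          (weilTowerPk_add_left W N) (weilTowerPk_add_right W N) (weilTowerPk_smul W N)).restrict
          (absGaloisRestrict ℚ (v.adicCompletion ℚ))).toLin
        (((TopRep.resFunctor (absGaloisRestrict ℚ (v.adicCompletion ℚ) :
            absoluteGaloisGroup (v.adicCompletion ℚ) →* absoluteGaloisGroup ℚ)).map
          (toTopRepHom (W.torsionGaloisModule ((p ^ j : ℕ) : ℤ)) (W.torsionGaloisModule ((p ^ N : ℕ) : ℤ)) ι)).hom x) y := by
    intro x y
    apply muVal_injective ℚ (p ^ N)
    apply Units.ext
    change weilTowerPk W j x (r y) = weilTowerPk W N (ι x) y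
    have hS : ((p ^ j * p ^ (N - j) : ℕ) : ℤ) • ((y : W.geomTorsion ((p ^ N : ℕ) : ℤ)) : W.geomPoints) = 0 := by
      rw [hlev]; exact (WeierstrassCurve.mem_geomTorsion_iff W _ _).1 y.2
    have hT : ((p ^ j : ℕ) : ℤ) • ((x : W.geomTorsion ((p ^ j : ℕ) : ℤ)) : W.geomPoints) = 0 :=
      (WeierstrassCurve.mem_geomTorsion_iff W _ _).1 x.2
    rw [weilTowerPk_apply, weilTowerPk_apply, hr, hι]
    exact (WeierstrassCurve.weilPairingFun_mul_right (natCast_pow_prime_ne_zero (p := p) j) hmm' hS hT).symm.trans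
      (weilPairingFun_congr_level W hlev hmm' _ _ _)
  /- (3) mixed naturality of the cup product along `(ι, r, μ_{p^j} ⊆ μ_{p^N})`, then everything is `0` -/
  have key := ContPairing.cupProduct_map_adjoint'
    ((contPairingOfFun (W.torsionGaloisModule ((p ^ j : ℕ) : ℤ)) (p ^ j) (weilTowerPk W j) (weilTowerPk_pow W j)
      (weilTowerPk_add_left W j) (weilTowerPk_add_right W j) (weilTowerPk_smul W j)).restrict
      (absGaloisRestrict ℚ (v.adicCompletion ℚ)))
    ((contPairingOfFun (W.torsionGaloisModule ((p ^ N : ℕ) : ℤ)) (p ^ N) (weilTowerPk W N) (weilTowerPk_pow W N)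
      (weilTowerPk_add_left W N) (weilTowerPk_add_right W N) (weilTowerPk_smul W N)).restrict
      (absGaloisRestrict ℚ (v.adicCompletion ℚ)))
    ((TopRep.resFunctor (absGaloisRestrict ℚ (v.adicCompletion ℚ) :
        absoluteGaloisGroup (v.adicCompletion ℚ) →* absoluteGaloisGroup ℚ)).map
      (toTopRepHom (W.torsionGaloisModule ((p ^ j : ℕ) : ℤ)) (W.torsionGaloisModule ((p ^ N : ℕ) : ℤ)) ι))
    ((TopRep.resFunctor (absGaloisRestrict ℚ (v.adicCompletion ℚ) :
        absoluteGaloisGroup (v.adicCompletion ℚ) →* absoluteGaloisGroup ℚ)).map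
      (toTopRepHom (W.torsionGaloisModule ((p ^ N : ℕ) : ℤ)) (W.torsionGaloisModule ((p ^ j : ℕ) : ℤ)) r))
    ((TopRep.resFunctor (absGaloisRestrict ℚ (v.adicCompletion ℚ) :
        absoluteGaloisGroup (v.adicCompletion ℚ) →* absoluteGaloisGroup ℚ)).map (muInclHom ℚ hdvd))
    hc ztj
    (ContinuousCohomology.map (absGaloisRestrict ℚ (v.adicCompletion ℚ))
      (𝟙 (TopRep.res (absGaloisRestrict ℚ (v.adicCompletion ℚ) :
        absoluteGaloisGroup (v.adicCompletion ℚ) →* absoluteGaloisGroup ℚ) (W.torsionGaloisModule ((p ^ N : ℕ) : ℤ)).toTopRep)) 1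
      (cores (W.torsionGaloisModule ((p ^ N : ℕ) : ℤ)).toTopRep U hU b))
  rw [← key, hY, map_zero, map_zero]
  exact map_zero _

end TorsionEulerChar.H46Obstruction

end Summit.BirchSwinnertonDyer.BirchSwinnertonDyer.Theorems

end
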